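import Summits.BirchSwinnertonDyer.BirchSwinnertonDyer.Theorems.ByReductionTypeAtTwoFineSelmerConjAAtTwoAdditivePotGoodNarrowRankCertificate63644LayerUnits
import HarnessLib

/-!
# Route `ByReductionTypeAtTwo` (rung K4), crux C1″ `FineSelmerConjAAtTwoAdditivePotGood` (item stmt-BirchSwinnertonDyer-22615):
# THE LAYER-`1` FIELD `A = ℚ(θ) ⊔ ℚ_1 = ℚ(θ, √2)` OF THE CUBIC FIELD OF DISCRIMINANT `63644`, PART C — `h(A)` is ODD (genus theory with the
# dyadic non-norm unit) and `[Cl⁺(A) : Cl⁺(A)²] = 2`: the narrow `2`-rank of the first cyclotomic layer of the point field of `445508b1` (KERNEL)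
# (a `--supports 22615` file; seat `bsd-2adic-k4-w1` GEN 10; sequel of `…NarrowRankCertificate63644LayerUnits`)

HONEST FRAMING (cell `bsd-2adic`, D-0036/D-0054/D-0152): KERNEL theorems about ONE totally real sextic field; no elliptic curve, no named fact, no
`sorry`, no definition. Closes nothing at the `∀`-level; nothing booked; BSD is not proved by any of this.

THE ARGUMENT. `A/E` (`E = ℚ(θ)`, `θ³ − θ² − 47θ + 95 = 0`) is quadratic and totally real; a finite prime `v ∌ 2` of `E` is unramified in `A = E(√2)`
(the different divides `2√2`, tree `isUnramifiedAt_of_sq_eq`), and the primes above `2` are `(π₁)`, `(π₂)` (`2 = u π₁² π₂`, `…63644Dyadic`), so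
`∏_𝔭 e_𝔭(A/E) ∣ 4`; `h(E) = 1` (kernel norm certificate); and the unit `ε = −10969 + 278θ + 246θ²` is not of the form `x² − 2y²`
(`ε ≡ 3 (mod π₂³)`, `…63644Dyadic`). Chevalley's formula (tree `AmbiguousClass.odd_classNumber_of_quadratic_of_isTotallyReal_of_forall_sq_sub_mul_sq_ne`,
this seat): **`h(A)` is odd**. With `#(U⁺/U²)(A) = 2` (part B) and `[Cl⁺ : (Cl⁺)²] = #(U⁺/U²)` for odd `h` (tree
`index_range_pow_two_narrowClassGroup_eq_card_totPosUnitsModSq_of_odd_classNumber`, this seat): **`[Cl⁺(A) : Cl⁺(A)²] = 2`** — equal to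
`[Cl⁺(E) : Cl⁺(E)²]` (`…63644Units`): the input `hr` of the narrow-Fukuda door for the census row `445508b1` (kit record addL2x GEN 8: `cyc6 = []`,
`F3(i) n0 = 0 R`), now KERNEL.

* `odd_classNumber_adjoin_sup_layer_one_d63644`, `index_range_pow_two_narrowClassGroup_adjoin_sup_layer_one_d63644` (`= 2`).

References: [Lang1990] Ch. 13 §4 Lemma 4.1; [NeukirchANT1999] Ch. III (2.6); [FrohlichTaylor1990] Ch. V §1 (1.8)–(1.13); [Washington1997] §13.1.
-/

set_option autoImplicit false
-- sibling precedent: the directory name repeats the summit name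
set_option linter.dupNamespace false

noncomputable section

open scoped Classical IntermediateField NumberField nonZeroDivisors

namespace Summit.BirchSwinnertonDyer.BirchSwinnertonDyer.Theorems.AddKatoTwo

open Polynomial IsDedekindDomain NumberField Field IntermediateField
  Literature.NumberTheory.EllipticCurves Literature.NumberTheory.EllipticCurves.ZpExtension
  Literature.NumberTheory.IwasawaTheory Literature.NumberTheory.NumberFields
  Literature.NumberTheory.GaloisRepresentations Literature.Geometry.Kaehler.ComplexTorus

variable {θ : AlgebraicClosure ℚ}

set_option maxHeartbeats 800000 in
/-- **`h(ℚ(θ) ⊔ ℚ_1)` is ODD for `θ³ − θ² − 47θ + 95 = 0`** (`ℚ(θ, √2)`, the first cyclotomic layer of the cubic field of discriminant `63644`,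
where `2 = 𝔭₁²𝔭₂`): genus theory for `ℚ(θ,√2)/ℚ(θ)` — at most the two dyadic primes ramify, no infinite place, `h(ℚ(θ)) = 1`, and the unit
`ε = −10969 + 278θ + 246θ²` is not a norm (dyadic certificate). KERNEL; matches the kit datum `cyc6 = []`.
[cite: Lang1990, Ch. 13 §4, Lemma 4.1 (PDF pp. 203–204)] [cite: NeukirchANT1999, Ch. III (2.6)] [cite: Washington1997, §13.1] -/
theorem odd_classNumber_adjoin_sup_layer_one_d63644
    (hθ : aeval θ (Cubic.toPoly ⟨1, ((-1 : ℤ) : ℚ), ((-47 : ℤ) : ℚ), ((95 : ℤ) : ℚ)⟩) = 0) :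
    haveI : FiniteDimensional ℚ ↥ℚ⟮θ⟯ :=
      IntermediateField.adjoin.finiteDimensional ⟨_, Cubic.monic_of_a_eq_one', by rwa [← aeval_def]⟩
    haveI : FiniteDimensional ℚ ↥((CyclotomicZp.zpExtension 2).layer 1) := (CyclotomicZp.zpExtension 2).finiteDimensional_layer_holds 1
    haveI : NumberField ↥(ℚ⟮θ⟯ ⊔ (CyclotomicZp.zpExtension 2).layer 1) := NumberField.mk
    Odd (classNumber ↥(ℚ⟮θ⟯ ⊔ (CyclotomicZp.zpExtension 2).layer 1)) := by
  haveI : FiniteDimensional ℚ ↥ℚ⟮θ⟯ :=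
    IntermediateField.adjoin.finiteDimensional ⟨_, Cubic.monic_of_a_eq_one', by rwa [← aeval_def]⟩
  haveI : FiniteDimensional ℚ ↥((CyclotomicZp.zpExtension 2).layer 1) := (CyclotomicZp.zpExtension 2).finiteDimensional_layer_holds 1
  haveI : NumberField ↥ℚ⟮θ⟯ := NumberField.mk
  haveI : NumberField ↥(ℚ⟮θ⟯ ⊔ (CyclotomicZp.zpExtension 2).layer 1) := NumberField.mk
  obtain ⟨hreal, hfinA, h3⟩ := layer_one_basics_d63644 hθ
  haveI := hreal
  haveI : IsTotallyReal ↥ℚ⟮θ⟯ := isTotallyReal_adjoin_d63644 hθ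
  obtain ⟨t, ht, ht2⟩ := CyclotomicZp.exists_mem_layer_one_sq_eq_two_zpExtension
  have hKA : ℚ⟮θ⟯ ≤ ℚ⟮θ⟯ ⊔ (CyclotomicZp.zpExtension 2).layer 1 := le_sup_left
  have htA : t ∈ ℚ⟮θ⟯ ⊔ (CyclotomicZp.zpExtension 2).layer 1 := (le_sup_right : (CyclotomicZp.zpExtension 2).layer 1 ≤ _) ht
  set t' : ↥(ℚ⟮θ⟯ ⊔ (CyclotomicZp.zpExtension 2).layer 1) := ⟨t, htA⟩ with ht'def
  have ht'2 : t' ^ 2 = 2 := by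
    apply (algebraMap ↥(ℚ⟮θ⟯ ⊔ (CyclotomicZp.zpExtension 2).layer 1) (AlgebraicClosure ℚ)).injective
    rw [map_pow, map_ofNat]
    exact ht2
  letI : Algebra ↥ℚ⟮θ⟯ ↥(ℚ⟮θ⟯ ⊔ (CyclotomicZp.zpExtension 2).layer 1) := (inclusion hKA).toRingHom.toAlgebra
  have halg : ∀ c : ↥ℚ⟮θ⟯, algebraMap ↥ℚ⟮θ⟯ ↥(ℚ⟮θ⟯ ⊔ (CyclotomicZp.zpExtension 2).layer 1) c = inclusion hKA c := fun _ => rfl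
  haveI : IsScalarTower ℚ ↥ℚ⟮θ⟯ ↥(ℚ⟮θ⟯ ⊔ (CyclotomicZp.zpExtension 2).layer 1) := IsScalarTower.of_algebraMap_eq fun q => ((inclusion hKA).commutes q).symm
  haveI : Module.Finite ↥ℚ⟮θ⟯ ↥(ℚ⟮θ⟯ ⊔ (CyclotomicZp.zpExtension 2).layer 1) := Module.Finite.of_restrictScalars_finite ℚ ↥ℚ⟮θ⟯ _
  have hdeg : Module.finrank ↥ℚ⟮θ⟯ ↥(ℚ⟮θ⟯ ⊔ (CyclotomicZp.zpExtension 2).layer 1) = 2 := by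
    have htower := Module.finrank_mul_finrank ℚ ↥ℚ⟮θ⟯ ↥(ℚ⟮θ⟯ ⊔ (CyclotomicZp.zpExtension 2).layer 1)
    rw [h3, hfinA] at htower
    omega
  haveI : Algebra.IsQuadraticExtension ↥ℚ⟮θ⟯ ↥(ℚ⟮θ⟯ ⊔ (CyclotomicZp.zpExtension 2).layer 1) := ⟨hdeg⟩
  haveI : IsGalois ↥ℚ⟮θ⟯ ↥(ℚ⟮θ⟯ ⊔ (CyclotomicZp.zpExtension 2).layer 1) := inferInstance
  -- `√2 ∉ ℚ(θ)`
  have htK : t' ∉ Set.range (algebraMap ↥ℚ⟮θ⟯ ↥(ℚ⟮θ⟯ ⊔ (CyclotomicZp.zpExtension 2).layer 1)) := by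
    rintro ⟨c, hc⟩
    obtain ⟨ρ, hρK, hρt⟩ := exists_ringHom_sup_layer_one_d63644 hθ ht ht2
      (InfinitePlace.embedding_of_isReal (IsTotallyReal.isReal (Classical.arbitrary (InfinitePlace ↥ℚ⟮θ⟯)))) (Real.sqrt 2) (Or.inl rfl)
    obtain ⟨ρ', hρ'K, hρ't⟩ := exists_ringHom_sup_layer_one_d63644 hθ ht ht2
      (InfinitePlace.embedding_of_isReal (IsTotallyReal.isReal (Classical.arbitrary (InfinitePlace ↥ℚ⟮θ⟯)))) (-Real.sqrt 2) (Or.inr rfl)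
    have h1 : ρ t' = ρ' t' := by rw [← hc, halg, hρK, hρ'K]
    rw [hρt, hρ't] at h1
    have := sqrt_two_bounds'; linarith [this.1]
  -- `A = ℚ(θ)(√2)` as an algebra
  have htint : IsIntegral ↥ℚ⟮θ⟯ t' := (Algebra.IsIntegral.isIntegral (R := ℚ) t').tower_top
  have hgen : IntermediateField.adjoin ↥ℚ⟮θ⟯ ({t'} : Set ↥(ℚ⟮θ⟯ ⊔ (CyclotomicZp.zpExtension 2).layer 1)) = ⊤ := by
    have h2le : 2 ≤ (minpoly ↥ℚ⟮θ⟯ t').natDegree := (minpoly.two_le_natDegree_iff htint).mpr htK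
    refine IntermediateField.eq_of_le_of_finrank_eq le_top ?_
    rw [IntermediateField.adjoin.finrank htint, IntermediateField.finrank_top', hdeg]
    exact le_antisymm ((minpoly.natDegree_le (A := ↥ℚ⟮θ⟯) (x := t')).trans hdeg.le) h2le
  have hgenA : Algebra.adjoin ↥ℚ⟮θ⟯ ({t'} : Set ↥(ℚ⟮θ⟯ ⊔ (CyclotomicZp.zpExtension 2).layer 1)) = ⊤ := by
    rw [← IntermediateField.adjoin_simple_toSubalgebra_of_isAlgebraic htint.isAlgebraic, hgen, IntermediateField.top_toSubalgebra]
  -- the integer `sA = √2`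
  have hsint : IsIntegral ℤ t' := ⟨X ^ 2 - C 2, monic_X_pow_sub_C _ two_ne_zero, by simp [ht'2]⟩
  set sA : 𝓞 ↥(ℚ⟮θ⟯ ⊔ (CyclotomicZp.zpExtension 2).layer 1) := ⟨t', hsint⟩ with hsAdef
  have hsAval : ((sA : 𝓞 ↥(ℚ⟮θ⟯ ⊔ (CyclotomicZp.zpExtension 2).layer 1)) : ↥(ℚ⟮θ⟯ ⊔ (CyclotomicZp.zpExtension 2).layer 1)) = t' := rfl
  have hsA2 : sA ^ 2 = algebraMap (𝓞 ↥ℚ⟮θ⟯) (𝓞 ↥(ℚ⟮θ⟯ ⊔ (CyclotomicZp.zpExtension 2).layer 1)) 2 := by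
    rw [map_ofNat]
    apply IsFractionRing.injective (𝓞 ↥(ℚ⟮θ⟯ ⊔ (CyclotomicZp.zpExtension 2).layer 1)) ↥(ℚ⟮θ⟯ ⊔ (CyclotomicZp.zpExtension 2).layer 1)
    rw [map_pow, map_ofNat, ← NumberField.RingOfIntegers.coe_eq_algebraMap, hsAval, ht'2]
  -- layer-0 data
  obtain ⟨-, -, -, -, -, -, b, eE, -, -, -, -, -, -, -, -, -, -, hbθ, hb, heEb, -, -, -, -, -, -, -⟩ := unitCertificate_adjoin_d63644 hθ
  have hK : Odd (classNumber ↥ℚ⟮θ⟯) := by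
    rw [NumberField.classNumber, ← Nat.card_eq_fintype_card,
      card_classGroup_adjoin_eq_one_of_forall_cubicField irreducible_cubic_d63644p_min (classNumber_eq_one_of_root_d63644p) hθ]
    exact odd_one
  -- the non-norm unit `ε`
  have hne : ∀ a c : ↥ℚ⟮θ⟯, a ^ 2 - 2 * c ^ 2 ≠ ((eE : 𝓞 ↥ℚ⟮θ⟯) : ↥ℚ⟮θ⟯) := by
    intro a c h
    have hno := not_exists_sq_sub_two_mul_sq_eq_eps_d63644 ↥ℚ⟮θ⟯ h3 b hb
    exact hno ⟨a, c, by rw [h, heEb]⟩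
  have hs : t' ^ 2 = algebraMap ↥ℚ⟮θ⟯ ↥(ℚ⟮θ⟯ ⊔ (CyclotomicZp.zpExtension 2).layer 1) 2 := by rw [map_ofNat]; exact ht'2
  -- at most the two dyadic primes ramify
  have hram : (∏ᶠ v : HeightOneSpectrum (𝓞 ↥ℚ⟮θ⟯), v.asIdeal.ramificationIdxIn (𝓞 ↥(ℚ⟮θ⟯ ⊔ (CyclotomicZp.zpExtension 2).layer 1))) ∣ 4 := by
    rw [AmbiguousClass.finprod_ramificationIdxIn_eq_pow_of_prime Nat.prime_two hdeg]
    obtain ⟨π₁, π₂, u, hunit, htwo, hP₁, hP₂, -, -, -, -⟩ := exists_dyadic_primes_d63644 ↥ℚ⟮θ⟯ h3 b hb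
    have hπ₁0 : Ideal.span {π₁} ≠ ⊥ := by
      rw [Ne, Ideal.span_singleton_eq_bot]; intro h0; rw [h0] at htwo; norm_num at htwo
    have hπ₂0 : Ideal.span {π₂} ≠ ⊥ := by
      rw [Ne, Ideal.span_singleton_eq_bot]; intro h0; rw [h0] at htwo; norm_num at htwo
    set v₁ : HeightOneSpectrum (𝓞 ↥ℚ⟮θ⟯) := ⟨Ideal.span {π₁}, hP₁, hπ₁0⟩ with hv₁
    set v₂ : HeightOneSpectrum (𝓞 ↥ℚ⟮θ⟯) := ⟨Ideal.span {π₂}, hP₂, hπ₂0⟩ with hv₂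
    have hsub : {v : HeightOneSpectrum (𝓞 ↥ℚ⟮θ⟯) | v.asIdeal.ramificationIdxIn (𝓞 ↥(ℚ⟮θ⟯ ⊔ (CyclotomicZp.zpExtension 2).layer 1)) ≠ 1} ⊆ {v₁, v₂} := by
      intro v hv
      rw [Set.mem_setOf_eq] at hv
      -- `2 ∈ v` (else `v` is unramified in `A = ℚ(θ)(√2)`)
      have h2v : (2 : 𝓞 ↥ℚ⟮θ⟯) ∈ v.asIdeal := by
        by_contra h2
        apply hv
        haveI := v.isMaximal
        obtain ⟨Q, hQmax, hQover⟩ := Ideal.exists_maximal_ideal_liesOver_of_isIntegral (S := 𝓞 ↥(ℚ⟮θ⟯ ⊔ (CyclotomicZp.zpExtension 2).layer 1)) v.asIdeal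
        haveI := hQmax
        haveI := hQover
        rw [Ideal.ramificationIdxIn_eq_ramificationIdx v.asIdeal Q (↥(ℚ⟮θ⟯ ⊔ (CyclotomicZp.zpExtension 2).layer 1) ≃ₐ[↥ℚ⟮θ⟯] ↥(ℚ⟮θ⟯ ⊔ (CyclotomicZp.zpExtension 2).layer 1))]
        have hunr : Algebra.IsUnramifiedAt (𝓞 ↥ℚ⟮θ⟯) Q := by
          refine isUnramifiedAt_of_sq_eq hsA2 hgenA Q fun hmem => h2 ?_
          have h8 : algebraMap (𝓞 ↥ℚ⟮θ⟯) (𝓞 ↥(ℚ⟮θ⟯ ⊔ (CyclotomicZp.zpExtension 2).layer 1)) (4 * 2) = 2 * (2 * 2) := by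
            rw [map_mul, map_ofNat, map_ofNat]; norm_num
          rw [h8] at hmem
          have h2Q : (2 : 𝓞 ↥(ℚ⟮θ⟯ ⊔ (CyclotomicZp.zpExtension 2).layer 1)) ∈ Q := by
            rcases (inferInstance : Q.IsPrime).mem_or_mem hmem with h | h
            · exact h
            · exact ((inferInstance : Q.IsPrime).mem_or_mem h).elim id id
          have h2u : (2 : 𝓞 ↥ℚ⟮θ⟯) ∈ Q.under (𝓞 ↥ℚ⟮θ⟯) := by
            rw [Ideal.under_def, Ideal.mem_comap, map_ofNat]; exact h2Q
          rwa [← Ideal.over_def Q v.asIdeal] at h2u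
        exact Ideal.ramificationIdx_eq_one_iff.mpr hunr
      -- `π₁ ∈ v ∨ π₂ ∈ v`
      rw [← htwo] at h2v
      have hπ : π₁ ∈ v.asIdeal ∨ π₂ ∈ v.asIdeal := by
        rcases v.isPrime.mem_or_mem h2v with h | h
        · rcases v.isPrime.mem_or_mem h with hu | hp
          · exact absurd (Ideal.eq_top_of_isUnit_mem _ hu hunit) v.isPrime.ne_top
          · exact Or.inl (v.isPrime.mem_of_pow_mem 2 hp)
        · exact Or.inr h
      simp only [Set.mem_insert_iff, Set.mem_singleton_iff]
      rcases hπ with h | h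
      · left
        apply HeightOneSpectrum.ext
        exact ((hP₁.isMaximal hπ₁0).eq_of_le v.isPrime.ne_top ((Ideal.span_singleton_le_iff_mem _).mpr h)).symm
      · right
        apply HeightOneSpectrum.ext
        exact ((hP₂.isMaximal hπ₂0).eq_of_le v.isPrime.ne_top ((Ideal.span_singleton_le_iff_mem _).mpr h)).symm
    have hle : {v : HeightOneSpectrum (𝓞 ↥ℚ⟮θ⟯) | v.asIdeal.ramificationIdxIn (𝓞 ↥(ℚ⟮θ⟯ ⊔ (CyclotomicZp.zpExtension 2).layer 1)) ≠ 1}.ncard ≤ 2 := by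
      refine (Set.ncard_le_ncard hsub (Set.toFinite _)).trans ?_
      exact (Set.ncard_insert_le v₁ {v₂}).trans (by rw [Set.ncard_singleton])
    calc 2 ^ {v : HeightOneSpectrum (𝓞 ↥ℚ⟮θ⟯) | v.asIdeal.ramificationIdxIn (𝓞 ↥(ℚ⟮θ⟯ ⊔ (CyclotomicZp.zpExtension 2).layer 1)) ≠ 1}.ncard ∣ 2 ^ 2 := pow_dvd_pow 2 hle
      _ = 4 := by norm_num
  exact AmbiguousClass.odd_classNumber_of_quadratic_of_isTotallyReal_of_forall_sq_sub_mul_sq_ne hdeg hram hs htK eE hne hK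

/-- **`[Cl⁺(A) : Cl⁺(A)²] = 2` for `A = ℚ(θ) ⊔ ℚ_1`, `θ³ − θ² − 47θ + 95 = 0`** (`rank₂ Cl⁺(ℚ(θ,√2)) = 1 = rank₂ Cl⁺(ℚ(θ))`): `h(A)` odd and
`#(U⁺/U²)(A) = 2`. KERNEL — the narrow rank certificate of the census row `445508b1` at `n₀ = 0`.
[cite: FrohlichTaylor1990, Ch. V §1 (1.8)–(1.13), pp. 163–164] [cite: Fukuda1994, Thm. 1 (2), p. 264] -/
theorem index_range_pow_two_narrowClassGroup_adjoin_sup_layer_one_d63644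
    (hθ : aeval θ (Cubic.toPoly ⟨1, ((-1 : ℤ) : ℚ), ((-47 : ℤ) : ℚ), ((95 : ℤ) : ℚ)⟩) = 0) :
    haveI : FiniteDimensional ℚ ↥ℚ⟮θ⟯ :=
      IntermediateField.adjoin.finiteDimensional ⟨_, Cubic.monic_of_a_eq_one', by rwa [← aeval_def]⟩
    haveI : FiniteDimensional ℚ ↥((CyclotomicZp.zpExtension 2).layer 1) := (CyclotomicZp.zpExtension 2).finiteDimensional_layer_holds 1
    haveI : NumberField ↥(ℚ⟮θ⟯ ⊔ (CyclotomicZp.zpExtension 2).layer 1) := NumberField.mk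
    (powMonoidHom (α := NarrowClassGroup ↥(ℚ⟮θ⟯ ⊔ (CyclotomicZp.zpExtension 2).layer 1)) 2).range.index = 2 := by
  haveI : FiniteDimensional ℚ ↥ℚ⟮θ⟯ :=
    IntermediateField.adjoin.finiteDimensional ⟨_, Cubic.monic_of_a_eq_one', by rwa [← aeval_def]⟩
  haveI : FiniteDimensional ℚ ↥((CyclotomicZp.zpExtension 2).layer 1) := (CyclotomicZp.zpExtension 2).finiteDimensional_layer_holds 1
  haveI : NumberField ↥(ℚ⟮θ⟯ ⊔ (CyclotomicZp.zpExtension 2).layer 1) := NumberField.mk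
  obtain ⟨hreal, -, -⟩ := layer_one_basics_d63644 hθ
  haveI := hreal
  rw [index_range_pow_two_narrowClassGroup_eq_card_totPosUnitsModSq_of_odd_classNumber (odd_classNumber_adjoin_sup_layer_one_d63644 hθ),
    card_totPosUnitsModSq_adjoin_sup_layer_one_d63644 hθ]

end Summit.BirchSwinnertonDyer.BirchSwinnertonDyer.Theorems.AddKatoTwo

end
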